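import Mathlib

/-!
# Tier7/Common/CurveAlg — the generic «curve algebra» `R ⊕ V ⊕ R·t` (t7-L1-p4; consumed by p1's `datumA` and p2's `SepDatum`)

Landed as shared API on p1's ask (l. 14810) confirmed by plan-1 (l. 14811 / l. 14828): one owner, one copy, for
`Tier7/Datum/AbelianShadow.lean` (p1: `HXA := CurveAlg ℂ V β ⊗[ℂ] CurveAlg ℂ V β′`) and p2's separating datum. Mathlib
only. The algebra of p2's design (l. 14712 (3)): for a commutative ring `R`, an `R`-module `V` and an
`R`-bilinear form `β : V → V → R`, `CurveAlg R V β = R ⊕ V ⊕ R·t` with `V·V → R·t` through `β`, `V·t = 0`, `t·t = 0`: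
`(r, v, a)·(r', v', a') = (r r', r v' + r' v, r a' + r' a + β(v, v'))`. It is an associative unital `R`-algebra for every
`β` (`mul_assoc` needs no symmetry), commutative iff `β` is symmetric (`mul_comm_of_symm`), with the `R`-linear TOP
functional `top (r, v, a) = a` (the coefficient of `t`: what `∫_X` reads off), `R ⊕ V` the part of «degree ≤ 1», and
FUNCTORIALITY `map`: a ring map `φ : R → R'` with a `φ`-semilinear additive map `ψ : V → V'` carrying `β` to `β'`
induces a ring map of curve algebras (the antilinear `bar` of the datum = `map` for `conj`; a Hecke translate = `map`
for an automorphism of `(V, β)` over the identity). Square-zero summands are obtained with `β = 0` on a factor.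

Nothing here is a fact about the surface: it is a carrier the data are glued on. §8(d): NO.
-/

namespace Summit.Ventures.HodgeRepro2.Tier7

/-- the curve algebra `R ⊕ V ⊕ R·t` attached to `(V, β)`: `r` = the scalar part, `v` = the degree-1 part, `a` = the
coefficient of the top element `t` -/
@[ext]
structure CurveAlg (R : Type*) [CommRing R] (V : Type*) [AddCommGroup V] [Module R V]
    (β : V →ₗ[R] V →ₗ[R] R) where
  /-- the scalar part -/
  r : R
  /-- the degree-1 part -/
  v : V
  /-- the coefficient of `t` -/
  a : R

namespace CurveAlg

variable {R : Type*} [CommRing R] {V : Type*} [AddCommGroup V] [Module R V] {β : V →ₗ[R] V →ₗ[R] R}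

/-! ### additive structure and `R`-module structure (componentwise) -/

/-- the `Zero` structure of the curve algebra (componentwise / by the formulas above) -/
instance : Zero (CurveAlg R V β) := ⟨⟨0, 0, 0⟩⟩
/-- the `Add` structure of the curve algebra (componentwise / by the formulas above) -/
instance : Add (CurveAlg R V β) := ⟨fun x y => ⟨x.r + y.r, x.v + y.v, x.a + y.a⟩⟩
/-- the `Neg` structure of the curve algebra (componentwise / by the formulas above) -/
instance : Neg (CurveAlg R V β) := ⟨fun x => ⟨-x.r, -x.v, -x.a⟩⟩
/-- the `Sub` structure of the curve algebra (componentwise / by the formulas above) -/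
instance : Sub (CurveAlg R V β) := ⟨fun x y => ⟨x.r - y.r, x.v - y.v, x.a - y.a⟩⟩
/-- the `SMul` structure of the curve algebra (componentwise / by the formulas above) -/
instance : SMul R (CurveAlg R V β) := ⟨fun c x => ⟨c * x.r, c • x.v, c * x.a⟩⟩

/-- component rule `zero_r` (by definition) -/
@[simp] theorem zero_r : (0 : CurveAlg R V β).r = 0 := rfl
/-- component rule `zero_v` (by definition) -/
@[simp] theorem zero_v : (0 : CurveAlg R V β).v = 0 := rfl
/-- component rule `zero_a` (by definition) -/
@[simp] theorem zero_a : (0 : CurveAlg R V β).a = 0 := rfl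
/-- component rule `add_r` (by definition) -/
@[simp] theorem add_r (x y : CurveAlg R V β) : (x + y).r = x.r + y.r := rfl
/-- component rule `add_v` (by definition) -/
@[simp] theorem add_v (x y : CurveAlg R V β) : (x + y).v = x.v + y.v := rfl
/-- component rule `add_a` (by definition) -/
@[simp] theorem add_a (x y : CurveAlg R V β) : (x + y).a = x.a + y.a := rfl
/-- component rule `neg_r` (by definition) -/
@[simp] theorem neg_r (x : CurveAlg R V β) : (-x).r = -x.r := rfl
/-- component rule `neg_v` (by definition) -/
@[simp] theorem neg_v (x : CurveAlg R V β) : (-x).v = -x.v := rfl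
/-- component rule `neg_a` (by definition) -/
@[simp] theorem neg_a (x : CurveAlg R V β) : (-x).a = -x.a := rfl
/-- component rule `sub_r` (by definition) -/
@[simp] theorem sub_r (x y : CurveAlg R V β) : (x - y).r = x.r - y.r := rfl
/-- component rule `sub_v` (by definition) -/
@[simp] theorem sub_v (x y : CurveAlg R V β) : (x - y).v = x.v - y.v := rfl
/-- component rule `sub_a` (by definition) -/
@[simp] theorem sub_a (x y : CurveAlg R V β) : (x - y).a = x.a - y.a := rfl
/-- component rule `smul_r` (by definition) -/
@[simp] theorem smul_r (c : R) (x : CurveAlg R V β) : (c • x).r = c * x.r := rfl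
/-- component rule `smul_v` (by definition) -/
@[simp] theorem smul_v (c : R) (x : CurveAlg R V β) : (c • x).v = c • x.v := rfl
/-- component rule `smul_a` (by definition) -/
@[simp] theorem smul_a (c : R) (x : CurveAlg R V β) : (c • x).a = c * x.a := rfl

/-- the `AddCommGroup` structure of the curve algebra (componentwise / by the formulas above) -/
instance : AddCommGroup (CurveAlg R V β) where
  add_assoc x y z := by ext <;> simp [add_assoc]
  zero_add x := by ext <;> simp
  add_zero x := by ext <;> simp
  nsmul := nsmulRec
  zsmul := zsmulRec
  neg_add_cancel x := by ext <;> simp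
  add_comm x y := by ext <;> simp [add_comm]
  sub_eq_add_neg x y := by ext <;> simp [sub_eq_add_neg]

/-- the `Module` structure of the curve algebra (componentwise / by the formulas above) -/
instance : Module R (CurveAlg R V β) where
  one_smul x := by ext <;> simp
  mul_smul c d x := by ext <;> simp [mul_assoc, mul_smul]
  smul_zero c := by ext <;> simp
  smul_add c x y := by ext <;> simp [mul_add, smul_add]
  add_smul c d x := by ext <;> simp [add_mul, add_smul]
  zero_smul x := by ext <;> simp

/-! ### multiplication -/

/-- the `One` structure of the curve algebra (componentwise / by the formulas above) -/
instance : One (CurveAlg R V β) := ⟨⟨1, 0, 0⟩⟩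
/-- the `Mul` structure of the curve algebra (componentwise / by the formulas above) -/
instance : Mul (CurveAlg R V β) :=
  ⟨fun x y => ⟨x.r * y.r, x.r • y.v + y.r • x.v, x.r * y.a + y.r * x.a + β x.v y.v⟩⟩

/-- component rule `one_r` (by definition) -/
@[simp] theorem one_r : (1 : CurveAlg R V β).r = 1 := rfl
/-- component rule `one_v` (by definition) -/
@[simp] theorem one_v : (1 : CurveAlg R V β).v = 0 := rfl
/-- component rule `one_a` (by definition) -/
@[simp] theorem one_a : (1 : CurveAlg R V β).a = 0 := rfl
/-- component rule `mul_r` (by definition) -/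
@[simp] theorem mul_r (x y : CurveAlg R V β) : (x * y).r = x.r * y.r := rfl
/-- component rule `mul_v` (by definition) -/
@[simp] theorem mul_v (x y : CurveAlg R V β) : (x * y).v = x.r • y.v + y.r • x.v := rfl
/-- component rule `mul_a` (by definition) -/
@[simp] theorem mul_a (x y : CurveAlg R V β) : (x * y).a = x.r * y.a + y.r * x.a + β x.v y.v := rfl

/-- the curve algebra is an associative unital ring (for every `β`) -/
instance : Ring (CurveAlg R V β) where
  mul_assoc x y z := by
    ext
    · simp [mul_assoc]
    · simp only [mul_v, mul_r, smul_add, smul_smul]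
      rw [mul_comm z.r x.r, mul_comm z.r y.r]
      abel
    · simp only [mul_a, mul_r, mul_v, map_add, map_smul, LinearMap.add_apply, LinearMap.smul_apply, smul_eq_mul]
      ring
  one_mul x := by ext <;> simp
  mul_one x := by ext <;> simp
  left_distrib x y z := by
    ext
    · simp [mul_add]
    · simp [smul_add, add_smul]
      abel
    · simp [mul_add, map_add]
      ring
  right_distrib x y z := by
    ext
    · simp [add_mul]
    · simp [smul_add, add_smul]
      abel
    · simp [add_mul, map_add]
      ring
  zero_mul x := by ext <;> simp
  mul_zero x := by ext <;> simp

/-- commutativity holds exactly when `β` is symmetric -/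
theorem mul_comm_of_symm (hβ : ∀ v w : V, β v w = β w v) (x y : CurveAlg R V β) : x * y = y * x := by
  ext
  · simp [mul_comm]
  · simp [add_comm]
  · simp [hβ x.v y.v]
    ring

/-- the commutative ring structure under a symmetric `β` (an `abbrev`, not an instance: the symmetry is a hypothesis) -/
abbrev commRingOfSymm (hβ : ∀ v w : V, β v w = β w v) : CommRing (CurveAlg R V β) :=
  { (inferInstance : Ring (CurveAlg R V β)) with mul_comm := mul_comm_of_symm hβ }

/-- the scalars `R → CurveAlg R V β`, `r ↦ (r, 0, 0)` -/
def ofScalar : R →+* CurveAlg R V β where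
  toFun r := ⟨r, 0, 0⟩
  map_one' := rfl
  map_mul' r s := by ext <;> simp
  map_zero' := rfl
  map_add' r s := by ext <;> simp

/-- component rule `ofScalar_r` (by definition) -/
@[simp] theorem ofScalar_r (r : R) : (ofScalar r : CurveAlg R V β).r = r := rfl
/-- component rule `ofScalar_v` (by definition) -/
@[simp] theorem ofScalar_v (r : R) : (ofScalar r : CurveAlg R V β).v = 0 := rfl
/-- component rule `ofScalar_a` (by definition) -/
@[simp] theorem ofScalar_a (r : R) : (ofScalar r : CurveAlg R V β).a = 0 := rfl

/-- the curve algebra is an `R`-algebra -/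
instance : Algebra R (CurveAlg R V β) where
  algebraMap := ofScalar
  commutes' r x := by ext <;> simp [mul_comm]
  smul_def' r x := by ext <;> simp

/-- component rule `algebraMap_apply` (by definition) -/
@[simp] theorem algebraMap_apply (r : R) : algebraMap R (CurveAlg R V β) r = ⟨r, 0, 0⟩ := rfl

/-- the degree-1 elements `(0, v, 0)` -/
def ofV : V →ₗ[R] CurveAlg R V β where
  toFun v := ⟨0, v, 0⟩
  map_add' v w := by ext <;> simp
  map_smul' c v := by ext <;> simp

/-- component rule `ofV_r` (by definition) -/
@[simp] theorem ofV_r (v : V) : (ofV v : CurveAlg R V β).r = 0 := rfl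
/-- component rule `ofV_v` (by definition) -/
@[simp] theorem ofV_v (v : V) : (ofV v : CurveAlg R V β).v = v := rfl
/-- component rule `ofV_a` (by definition) -/
@[simp] theorem ofV_a (v : V) : (ofV v : CurveAlg R V β).a = 0 := rfl

/-- the top element `t = (0, 0, 1)` -/
def t : CurveAlg R V β := ⟨0, 0, 1⟩

/-- component rule `t_r` (by definition) -/
@[simp] theorem t_r : (t : CurveAlg R V β).r = 0 := rfl
/-- component rule `t_v` (by definition) -/
@[simp] theorem t_v : (t : CurveAlg R V β).v = 0 := rfl
/-- component rule `t_a` (by definition) -/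
@[simp] theorem t_a : (t : CurveAlg R V β).a = 1 := rfl

/-- `v · w = β(v, w)·t` for degree-1 elements -/
theorem ofV_mul_ofV (v w : V) : (ofV v : CurveAlg R V β) * ofV w = β v w • t := by
  ext <;> simp

/-- `v · t = 0` -/
theorem ofV_mul_t (v : V) : (ofV v : CurveAlg R V β) * t = 0 := by
  ext <;> simp

/-- `t · t = 0` -/
theorem t_mul_t : (t : CurveAlg R V β) * t = 0 := by
  ext <;> simp

/-- every element is `r + v + a·t` -/
theorem eq_ofScalar_add_ofV_add_smul_t (x : CurveAlg R V β) :
    x = ofScalar x.r + ofV x.v + x.a • t := by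
  ext <;> simp

/-- the TOP functional: the coefficient of `t` (`R`-linear) -/
def top : CurveAlg R V β →ₗ[R] R where
  toFun x := x.a
  map_add' _ _ := rfl
  map_smul' _ _ := rfl

/-- component rule `top_apply` (by definition) -/
@[simp] theorem top_apply (x : CurveAlg R V β) : top x = x.a := rfl

/-- `t · x = x.r · t`: the top element kills everything of positive degree -/
theorem t_mul (x : CurveAlg R V β) : (t : CurveAlg R V β) * x = x.r • t := by
  ext <;> simp

/-- `x · t = x.r · t` -/
theorem mul_t (x : CurveAlg R V β) : x * (t : CurveAlg R V β) = x.r • t := by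
  ext <;> simp

/-- `top` of a product of two degree-1 elements is the form -/
theorem top_ofV_mul_ofV (v w : V) : top ((ofV v : CurveAlg R V β) * ofV w) = β v w := by simp

/-! ### functoriality -/

section Map

variable {R' : Type*} [CommRing R'] {V' : Type*} [AddCommGroup V'] [Module R' V'] {β' : V' →ₗ[R'] V' →ₗ[R'] R'}

/-- a ring map `φ : R → R'` and a `φ`-semilinear additive map `ψ : V → V'` carrying `β` to `β'` induce a ring map of
curve algebras `(r, v, a) ↦ (φ r, ψ v, φ a)` -/
def map (φ : R →+* R') (ψ : V →+ V') (hψ : ∀ (c : R) (v : V), ψ (c • v) = φ c • ψ v)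
    (hβ : ∀ v w : V, β' (ψ v) (ψ w) = φ (β v w)) : CurveAlg R V β →+* CurveAlg R' V' β' where
  toFun x := ⟨φ x.r, ψ x.v, φ x.a⟩
  map_one' := by ext <;> simp
  map_mul' x y := by ext <;> simp [hψ, hβ]
  map_zero' := by ext <;> simp
  map_add' x y := by ext <;> simp

/-- component rule `map_r` (by definition) -/
@[simp] theorem map_r (φ : R →+* R') (ψ : V →+ V') (hψ : ∀ (c : R) (v : V), ψ (c • v) = φ c • ψ v)
    (hβ : ∀ v w : V, β' (ψ v) (ψ w) = φ (β v w)) (x : CurveAlg R V β) : (map φ ψ hψ hβ x).r = φ x.r := rfl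
/-- component rule `map_v` (by definition) -/
@[simp] theorem map_v (φ : R →+* R') (ψ : V →+ V') (hψ : ∀ (c : R) (v : V), ψ (c • v) = φ c • ψ v)
    (hβ : ∀ v w : V, β' (ψ v) (ψ w) = φ (β v w)) (x : CurveAlg R V β) : (map φ ψ hψ hβ x).v = ψ x.v := rfl
/-- component rule `map_a` (by definition) -/
@[simp] theorem map_a (φ : R →+* R') (ψ : V →+ V') (hψ : ∀ (c : R) (v : V), ψ (c • v) = φ c • ψ v)
    (hβ : ∀ v w : V, β' (ψ v) (ψ w) = φ (β v w)) (x : CurveAlg R V β) : (map φ ψ hψ hβ x).a = φ x.a := rfl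

/-- `map` is injective when `φ` and `ψ` are -/
theorem map_injective (φ : R →+* R') (ψ : V →+ V') (hψ : ∀ (c : R) (v : V), ψ (c • v) = φ c • ψ v)
    (hβ : ∀ v w : V, β' (ψ v) (ψ w) = φ (β v w)) (hφi : Function.Injective φ) (hψi : Function.Injective ψ) :
    Function.Injective (map φ ψ hψ hβ) := by
  intro x y hxy
  have h1 := congrArg CurveAlg.r hxy
  have h2 := congrArg CurveAlg.v hxy
  have h3 := congrArg CurveAlg.a hxy
  simp only [map_r, map_v, map_a] at h1 h2 h3
  ext
  · exact hφi h1
  · exact hψi h2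
  · exact hφi h3

/-- `map` commutes with `top` -/
theorem top_map (φ : R →+* R') (ψ : V →+ V') (hψ : ∀ (c : R) (v : V), ψ (c • v) = φ c • ψ v)
    (hβ : ∀ v w : V, β' (ψ v) (ψ w) = φ (β v w)) (x : CurveAlg R V β) :
    top (map φ ψ hψ hβ x) = φ (top x) := rfl

/-- `map` for the identity on `R` and an `R`-linear automorphism of `(V, β)` is `R`-linear -/
theorem map_smul_id (ψ : V →ₗ[R] V) (hβ : ∀ v w : V, β (ψ v) (ψ w) = β v w) (c : R) (x : CurveAlg R V β) :
    map (RingHom.id R) ψ.toAddMonoidHom (fun _ _ => by simp) hβ (c • x) =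
      c • map (RingHom.id R) ψ.toAddMonoidHom (fun _ _ => by simp) hβ x := by
  ext <;> simp

/-- a ring isomorphism `R ≃ R'` and a compatible additive isomorphism `V ≃ V'` carrying `β` to `β'` give a ring
isomorphism of curve algebras (the inverse is `map` of the inverses) -/
def equiv (φ : R ≃+* R') (ψ : V ≃+ V') (hψ : ∀ (c : R) (v : V), ψ (c • v) = φ c • ψ v)
    (hβ : ∀ v w : V, β' (ψ v) (ψ w) = φ (β v w)) : CurveAlg R V β ≃+* CurveAlg R' V' β' where
  toFun := map φ.toRingHom ψ.toAddMonoidHom hψ hβ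
  invFun x := ⟨φ.symm x.r, ψ.symm x.v, φ.symm x.a⟩
  left_inv x := by ext <;> simp
  right_inv x := by ext <;> simp
  map_mul' := (map φ.toRingHom ψ.toAddMonoidHom hψ hβ).map_mul
  map_add' := (map φ.toRingHom ψ.toAddMonoidHom hψ hβ).map_add

/-- component rule `equiv_apply` (by definition) -/
@[simp] theorem equiv_apply (φ : R ≃+* R') (ψ : V ≃+ V') (hψ : ∀ (c : R) (v : V), ψ (c • v) = φ c • ψ v)
    (hβ : ∀ v w : V, β' (ψ v) (ψ w) = φ (β v w)) (x : CurveAlg R V β) :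
    equiv φ ψ hψ hβ x = ⟨φ x.r, ψ x.v, φ x.a⟩ := rfl

end Map

end CurveAlg

end Summit.Ventures.HodgeRepro2.Tier7
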